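import Summits.HodgeConjecture.HodgeConjecture.Theses.QbarEnvelope
import Summits.HodgeConjecture.HodgeConjecture.Theorems.AnchorTransportVariationalHodgeAnalyticInterior
import Literature.AlgebraicGeometry.HodgeTheory.ConjugateComplexPoints
import Literature.AlgebraicGeometry.HodgeTheory.AlgebraicityLocusProofs
import Literature.AlgebraicGeometry.HodgeTheory.QbarFamilyLocalSystem
import Literature.AlgebraicGeometry.HodgeTheory.GysinKernel
import Literature.AlgebraicGeometry.Motives.CurveThroughTwoPointsProofs
import Mathlib.Topology.GDelta.Basic
import HarnessLib

/-!
# Crux `Envelope` (stmt-HodgeConjecture-1069), line `hodge_rank_conjugation` — registered stub J2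
# `stub_isMeagre_compl_orbit_of_qbarGeneric`, PROVED

Route `QbarEnvelope` of `HodgeConjecture`. Stub J2 of the registered skeleton
`Cruxes/Envelope/Lines/hodge_rank_conjugation.lean`:

> **the `Aut(ℂ/ℚ̄)`-orbit of a `ℚ̄`-generic point is comeagre** — for `S₀` smooth irreducible
> quasi-projective over `ℚ̄`, `S = S₀ ⊗_σ ℂ`, and `s ∈ S(ℂ)` lying over the generic point of `S₀`,
> the complement of `{τ · s : τ ∈ Aut(ℂ/σℚ̄)}` (`HodgeTheory.conjPoint`) is meagre in `S(ℂ)`.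

Proof, entirely from tree theorems (Lang, *Introduction to Algebraic Geometry*, III §4–§5;
Charles–Schnell, proof of Thm. 11.2.8 and Lemma 11.3.14):

1. A complex point `t` over the SAME point of `S₀` as `s` is a conjugate `τ · s`
   (`HodgeTheory.exists_conjPoint_eq_of_base_pt_eq`: two embeddings of the countable residue field are
   conjugate under `Aut(ℂ/σℚ̄)`). Hence the complement of the orbit lies in the set `L` of complex
   points NOT over `η = π(s)`.
2. `L` is stable under specialisation of the underlying point of `S₀` (`η` is the generic point:
   `closure {η} = S₀`, and `S₀` is `T₀`), so, `S₀` having countably many points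
   (`countable_of_isQuasiProjectiveOver`, `ℚ̄` countable), `L` is a countable union of sets
   `{t | π(t) ∈ W_j}`, `W_j ⊆ S₀` Zariski closed (`exists_iUnion_setOf_base_pt_mem_eq_of_specializes`).
3. Each `{t | π(t) ∈ W_j} = {t | pt t ∈ π⁻¹W_j}` is closed in `S(ℂ)` (the analytic topology refines
   the Zariski topology, `isClosed_setOf_pt_mem`) and misses `s`, so `π⁻¹ W_j ⊊ S` is a proper
   Zariski-closed subset of the smooth irreducible `S` (`irreducibleSpace_baseChangeHom_left`), whose
   set of complex points has EMPTY analytic interior (`eq_univ_of_isClosed_of_interior_nonempty_of_irreducible`,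
   Mumford's curve lemma being the tree theorem `mumford_smoothCurve_through_two_points_holds`);
   closed with empty interior = nowhere dense, hence meagre, and a countable union of meagre sets is
   meagre (Mathlib `isMeagre_iUnion`).

No named fact, no sorry. The theorem below has the REGISTERED SIGNATURE VERBATIM.

## References

* [Lang1958IAG] S. Lang, Introduction to Algebraic Geometry (1958), Ch. III §4 Thm. 9 and §5.
* [CharlesSchnell2014Notes] F. Charles, C. Schnell, Notes on absolute Hodge classes, in Hodge Theory
  (Princeton Math. Notes 49, 2014), proof of Thm. 11.2.8 and Lemma 11.3.14.
* [MumfordAV1970] D. Mumford, Abelian Varieties (1970), §6, Lemma.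
-/

noncomputable section

-- `Summit.HodgeConjecture.HodgeConjecture.…` is the mandated namespace (single-conjunct summit).
set_option linter.dupNamespace false

namespace Summit.HodgeConjecture.HodgeConjecture.Theorems.Envelope

open CategoryTheory AlgebraicGeometry Topology
open Literature.AlgebraicGeometry Literature.AlgebraicGeometry.Motives
open Literature.AlgebraicGeometry.HodgeTheory

/-- **Registered stub `stub_isMeagre_compl_orbit_of_qbarGeneric` (J2) of the line
`hodge_rank_conjugation`** (crux `Envelope`, stmt-HodgeConjecture-1069), verbatim: for `S₀` smooth
irreducible quasi-projective over `ℚ̄` and a complex point `s` of `S = S₀ ⊗_σ ℂ` over the generic point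
of `S₀`, the complement of the `Aut(ℂ/σℚ̄)`-orbit `{τ · s}` is meagre in `S(ℂ)`. Points over `π(s)` are
conjugates of `s`; the others lie over the countably many non-generic points of `S₀`, on countably
many sets of complex points of proper Zariski-closed subsets of the smooth irreducible `S`, each closed
and nowhere dense in the analytic topology. [cite: Lang1958IAG, Ch. III §4 Thm. 9 and §5]
[cite: CharlesSchnell2014Notes, proof of Thm. 11.2.8 and Lemma 11.3.14] -/
theorem stub_isMeagre_compl_orbit_of_qbarGeneric :
    ∀ (σ : AlgebraicClosure ℚ →+* ℂ) (S₀ : SchemeOver (AlgebraicClosure ℚ)),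
      IsQuasiProjectiveOver S₀ → IrreducibleSpace S₀.left → AlgebraicGeometry.Smooth S₀.hom →
      ∀ (s : ComplexPoints ((baseChangeHom σ).obj S₀)),
        closure {(baseChangeHomFst σ S₀).base s.pt} = (Set.univ : Set S₀.left) →
        IsMeagre (Set.range fun τ : ringAutOver σ ↦ conjPoint σ S₀ τ s)ᶜ := by
  intro σ S₀ hS₀ hirr hsm s hgen
  classical
  haveI := hirr
  haveI := hsm
  -- countability and finiteness hypotheses
  haveI : Countable (AlgebraicClosure ℚ) :=
    Cardinal.mk_le_aleph0_iff.mp cardinalMk_algebraicClosure_rat_le_aleph0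
  haveI : Countable S₀.left := countable_of_isQuasiProjectiveOver hS₀
  haveI : LocallyOfFiniteType S₀.hom := hS₀.isVarietyPair_ofScheme.locallyOfFiniteType
  -- `S = S₀ ⊗ ℂ` is smooth and irreducible
  haveI : IrreducibleSpace ((baseChangeHom σ).obj S₀).left := irreducibleSpace_baseChangeHom_left σ
  haveI : AlgebraicGeometry.Smooth ((baseChangeHom σ).obj S₀).hom := by
    change AlgebraicGeometry.Smooth (Limits.pullback.snd S₀.hom _)
    infer_instance
  -- the projection to `S₀` on complex points, and the non-generic locus `L`
  set π : ComplexPoints ((baseChangeHom σ).obj S₀) → S₀.left :=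
    fun t => (baseChangeHomFst σ S₀).base t.pt with hπ
  set L : Set (ComplexPoints ((baseChangeHom σ).obj S₀)) := {t | π t ≠ π s} with hL
  -- 1. the complement of the orbit lies in `L`
  have hsub : (Set.range fun τ : ringAutOver σ ↦ conjPoint σ S₀ τ s)ᶜ ⊆ L := by
    intro t ht heq
    obtain ⟨τ, hτ⟩ := exists_conjPoint_eq_of_base_pt_eq σ S₀ cardinalMk_algebraicClosure_rat_le_aleph0
      (s := s) (t := t) (by simpa [hπ] using heq.symm)
    exact ht ⟨τ, hτ⟩
  have hsL : s ∉ L := fun h => h rfl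
  -- 2. `L` is stable under specialisation, hence a countable union over Zariski-closed `W_j ⊆ S₀`
  have hgen' : ∀ x : S₀.left, π s ∈ closure ({x} : Set S₀.left) → x = π s := by
    intro x hx
    have hcl : closure ({x} : Set S₀.left) = Set.univ := by
      apply Set.eq_univ_of_univ_subset
      rw [← hgen]
      exact closure_minimal (Set.singleton_subset_iff.mpr hx) isClosed_closure
    have hins : Inseparable x (π s) := by
      rw [inseparable_iff_closure_eq, hcl]
      exact hgen.symm
    exact hins.eq
  have hLspec : ∀ ⦃s' t : ComplexPoints ((baseChangeHom σ).obj S₀)⦄,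
      (baseChangeHomFst σ S₀).base s'.pt ⤳ (baseChangeHomFst σ S₀).base t.pt → s' ∈ L → t ∈ L := by
    intro s' t hst hs' ht
    apply hs'
    change π s' ⤳ π t at hst
    rw [ht] at hst
    exact hgen' (π s') (specializes_iff_mem_closure.mp hst)
  obtain ⟨W, hWc, hLW⟩ := exists_iUnion_setOf_base_pt_mem_eq_of_specializes σ S₀ hLspec
  -- 3. each piece is closed and nowhere dense in `S(ℂ)`
  refine IsMeagre.mono hsub ?_
  rw [hLW]
  refine isMeagre_iUnion fun j => ?_
  set Z : Set ((baseChangeHom σ).obj S₀).left := (baseChangeHomFst σ S₀).base ⁻¹' W j with hZ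
  have hZc : IsClosed Z := (hWc j).preimage (baseChangeHomFst σ S₀).base.hom.continuous
  have hpiece : {t : ComplexPoints ((baseChangeHom σ).obj S₀) |
      (baseChangeHomFst σ S₀).base t.pt ∈ W j} =
      {t : ComplexPoints ((baseChangeHom σ).obj S₀) | t.pt ∈ Z} := rfl
  rw [hpiece]
  have hcl : IsClosed {t : ComplexPoints ((baseChangeHom σ).obj S₀) | t.pt ∈ Z} :=
    isClosed_setOf_pt_mem hZc
  -- the piece misses `s`, so `Z ⊊ S`
  have hsZ : s.pt ∉ Z := by
    intro h
    apply hsL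
    rw [hLW]
    exact Set.mem_iUnion.mpr ⟨j, h⟩
  have hZne : Z ≠ Set.univ := fun h => hsZ (h ▸ Set.mem_univ _)
  have hint : interior {t : ComplexPoints ((baseChangeHom σ).obj S₀) | t.pt ∈ Z} = ∅ := by
    by_contra hne
    exact hZne (eq_univ_of_isClosed_of_interior_nonempty_of_irreducible
      mumford_smoothCurve_through_two_points_holds hZc (Set.nonempty_iff_ne_empty.mpr hne))
  exact (hcl.isNowhereDense_iff.mpr hint).isMeagre

end Summit.HodgeConjecture.HodgeConjecture.Theorems.Envelope

end
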